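import Mathlib
import Summits.ValiantsHypothesis.ValiantsHypothesis.Theses.GrenetZeon
import Summits.ValiantsHypothesis.ValiantsHypothesis.Theorems.GrenetZeonTwoDimCoefficientsDefs
import Summits.ValiantsHypothesis.ValiantsHypothesis.Theorems.GrenetZeonTwoDimCoefficientsDualJet
import Literature.Computability.AlgebraicComplexity.MignonRessayreBound
import Literature.Computability.AlgebraicComplexity.LandsbergRessayreNormalForm

/-!
# Crux `GrenetZeon.TwoDimCoefficients` (stmt-ValiantsHypothesis-8062), line `dim2_cases` —
# registered stub `stub_dualCase`: the DUAL shape `per_n = α det A + β tr(adj A · B)`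

**Claim settled** (TRUE given its three hypotheses, which the registered signature takes by name):
`HessianRankCodimTwo → UnitDichotomy → DualUnipotentBound →
∃ C n₀, ∀ n ≥ n₀, ∀ m, DualRepr n m → n² ≤ C·m`, with `C = max 12 C_D` and
`n₀ = max (max n₀(HessianRankCodimTwo) 3) n_D`, where `(C_D, n_D)` are the constants of
`DualUnipotentBound`.

* `HessianRankCodimTwo` is the dependency crux stmt-ValiantsHypothesis-8061; `UnitDichotomy` is the
  line's stub 2; `DualUnipotentBound` (the isolated sub-case `det A ≡ c ≠ 0`, stub 5, flagged OPEN by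
  the line card) is the line's stub 5.  All three are HYPOTHESES here, exactly as registered.
* Proof (`stub_dualCase`).  COMMON ZERO of `per_n` and `det A`: at the point `p` of
  `HessianRankCodimTwo`, `Hess per_n(p) = α Hess det A(p) + β Hess tr(adj A · B)(p)`; the first
  summand has rank `≤ 2m` (tree: `rank_hess0_det_le`, translated), and — the jet count, done
  UNIFORMLY in `GrenetZeonTwoDimCoefficientsDualJet.lean` (`rank_hess0_trace_adjugate_mul_le`) instead
  of the card's corank case analysis — the second has rank `≤ 4m`, because `tr(adj A · B)(p) =
  (per_n(p) − α det A(p))/β = 0` when `β ≠ 0`.  So `n² < 2·6m = 12m`.  NO COMMON ZERO: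
  `UnitDichotomy` for `A` gives `n² ≤ 2m + 2 ≤ 12m` (`n ≥ 3`) or `det A = c`, and then `c ≠ 0`
  (`per_n(0) = 0` is a zero of `per_n`, where `det A` may not vanish), i.e. `DualUnipotentRepr n m`
  holds and `DualUnipotentBound` gives `n² ≤ C_D·m`.

HONEST FRAMING: a conditional constant-factor bound inside the Mignon–Ressayre regime, serving an
ASIDE item; the line's open content sits in the hypothesis `DualUnipotentBound`; nothing here bears
on `VP ≠ VNP`.

References: T. Mignon, N. Ressayre, *A quadratic bound for the determinant and permanent problem*,
Int. Math. Res. Not. 2004:79, Thm. 1.1, §2; J. M. Landsberg, *Geometry and Complexity Theory*, CUP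
2017, §6.4.5–6.4.6.
-/

-- single-conjunct layout `Summits/ValiantsHypothesis/ValiantsHypothesis`: the duplicated namespace
-- component is mandated by the tree.
set_option linter.dupNamespace false

noncomputable section

namespace Summit.ValiantsHypothesis.ValiantsHypothesis.Cruxes.TwoDimCoefficients.DimTwoCases

open MvPolynomial Matrix
open Literature.Computability.AlgebraicComplexity
open Summit.ValiantsHypothesis.ValiantsHypothesis.Theses.GrenetZeon
open Summit.ValiantsHypothesis.ValiantsHypothesis.Theorems.GrenetZeonTwoDimCoefficients

namespace DualCase

/-- At a zero `p` of an affine determinant `det A`, the Hessian of `det A` at `p` has rank `≤ 2m`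
(the tree's `rank_hess0_det_le` after translation). [cite: MignonRessayre2004, §2] -/
theorem rank_hess0_transl_det_le {n m : ℕ} (A : AffMat n m) (hA : IsAffine A)
    (p : Fin n × Fin n → ℂ) (hp : eval p A.det = 0) :
    (hess0 (transl p A.det)).rank ≤ 2 * m := by
  rw [AlgHom.map_det]
  refine rank_hess0_det_le _ (fun i j => ?_) ?_
  · rw [AlgHom.mapMatrix_apply, Matrix.map_apply]
    exact (totalDegree_transl_le p (A i j)).trans (hA i j)
  · rw [← AlgHom.map_det, constantCoeff_transl, hp]

/-- At a common zero `p` of `det A` and `tr(adj A · B)` (`A`, `B` affine), the Hessian of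
`tr(adj A · B)` at `p` has rank `≤ 4m` (the dual jet count `rank_hess0_trace_adjugate_mul_le` after
translation). [folklore] -/
theorem rank_hess0_transl_trace_le {n m : ℕ} (A B : AffMat n m) (hA : IsAffine A) (hB : IsAffine B)
    (p : Fin n × Fin n → ℂ) (hpA : eval p A.det = 0) (hpT : eval p (A.adjugate * B).trace = 0) :
    (hess0 (transl p (A.adjugate * B).trace)).rank ≤ 4 * m := by
  have hmap : transl p (A.adjugate * B).trace =
      (((transl p).mapMatrix A).adjugate * (transl p).mapMatrix B).trace := by
    rw [← AlgHom.map_adjugate, ← map_mul]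
    simp only [AlgHom.mapMatrix_apply, Matrix.trace, Matrix.diag_apply, map_sum, Matrix.map_apply]
  rw [hmap]
  refine rank_hess0_trace_adjugate_mul_le _ _ (fun i j => ?_) (fun i j => ?_) ?_ ?_
  · rw [AlgHom.mapMatrix_apply, Matrix.map_apply]
    exact (totalDegree_transl_le p (A i j)).trans (hA i j)
  · rw [AlgHom.mapMatrix_apply, Matrix.map_apply]
    exact (totalDegree_transl_le p (B i j)).trans (hB i j)
  · rw [← AlgHom.map_det, constantCoeff_transl, hpA]
  · rw [← hmap, constantCoeff_transl, hpT]

/-- Scaling does not raise the rank, in the form used below. [folklore] -/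
theorem rank_smul_hess0_le {n : ℕ} (c : ℂ) (f : MvPolynomial (Fin n × Fin n) ℂ) (b : ℕ)
    (h : c ≠ 0 → (hess0 f).rank ≤ b) : (c • hess0 f).rank ≤ b := by
  by_cases hc : c = 0
  · rw [hc, zero_smul, Matrix.rank_zero]; exact Nat.zero_le _
  · exact (rank_smul_le c _).trans (h hc)

/-- **Common-zero case of the DUAL shape.** If `per_n = α det A + β tr(adj A · B)` with `A`, `B`
affine and `p` is a common zero of `per_n` and `det A`, then the Hessian of `per_n` at `p` has rank
`≤ 6m` (`2m` from the determinant, `4m` from the jet, which vanishes at `p` unless `β = 0`).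
[folklore] -/
theorem rank_hess0_transl_perPoly_le_of_dual {n m : ℕ} {α β : ℂ} {A B : AffMat n m}
    (hA : IsAffine A) (hB : IsAffine B)
    (hper : perPoly (Fin n) ℂ = C α * A.det + C β * (A.adjugate * B).trace)
    (p : Fin n × Fin n → ℂ) (hp : eval p (perPoly (Fin n) ℂ) = 0) (hpA : eval p A.det = 0) :
    (hess0 (transl p (perPoly (Fin n) ℂ))).rank ≤ 6 * m := by
  have hsplit : hess0 (transl p (perPoly (Fin n) ℂ)) =
      α • hess0 (transl p A.det) + β • hess0 (transl p (A.adjugate * B).trace) := by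
    conv_lhs => rw [hper]
    rw [map_add, map_mul, map_mul, transl_C, transl_C, map_add, hess0_C_mul, hess0_C_mul]
  rw [hsplit]
  refine (rank_add_le _ _).trans ?_
  have h1 : (α • hess0 (transl p A.det)).rank ≤ 2 * m :=
    rank_smul_hess0_le α _ _ fun _ => rank_hess0_transl_det_le A hA p hpA
  have h2 : (β • hess0 (transl p (A.adjugate * B).trace)).rank ≤ 4 * m := by
    refine rank_smul_hess0_le β _ _ fun hβ => rank_hess0_transl_trace_le A B hA hB p hpA ?_
    have h := congrArg (eval p) hper
    rw [map_add, map_mul, map_mul, eval_C, eval_C, hp, hpA, mul_zero, zero_add] at h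
    exact (mul_eq_zero.mp h.symm).resolve_left hβ
  omega

end DualCase

open DualCase in
/-- **Registered stub `stub_dualCase`** (line `dim2_cases`, crux `TwoDimCoefficients`,
stmt-ValiantsHypothesis-8062): in the DUAL shape `per_n = α det A + β tr(adj A · B)` (`A`, `B`
affine `m × m`), the codimension-two Hessian point (`HessianRankCodimTwo`, stmt-8061, hypothesis),
the unit dichotomy and the bound in the isolated unipotent sub-case give `n² ≤ max(12, C_D)·m` for
large `n`.  Proof.  A common zero of `per_n` and `det A`: at the point of `HessianRankCodimTwo` the
Hessian of `per_n` has rank `≤ 2m + 4m` (`rank_hess0_transl_perPoly_le_of_dual`), so `n² < 12m`.  No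
common zero: `UnitDichotomy` for `A` gives `n² ≤ 2m + 2 ≤ 12m` or `det A = c`; then `c ≠ 0` (the
origin is a zero of `per_n`), so `DualUnipotentRepr n m` holds and `DualUnipotentBound` applies.
[folklore] -/
theorem stub_dualCase : HessianRankCodimTwo → UnitDichotomy → DualUnipotentBound →
    ∃ C n₀ : ℕ, ∀ n ≥ n₀, ∀ m : ℕ, DualRepr n m → n ^ 2 ≤ C * m := by
  rintro ⟨nH, hH⟩ hU ⟨CD, nD, hD⟩
  refine ⟨max 12 CD, max (max nH 3) nD, fun n hn m hS => ?_⟩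
  have hnH : nH ≤ n := ((le_max_left _ _).trans (le_max_left _ _)).trans hn
  have hn3 : 3 ≤ n := ((le_max_right _ _).trans (le_max_left _ _)).trans hn
  have hnD : nD ≤ n := (le_max_right _ _).trans hn
  have hn1 : 1 ≤ n := by omega
  have h9 : 9 ≤ n ^ 2 := by
    calc (9 : ℕ) = 3 ^ 2 := by norm_num
      _ ≤ n ^ 2 := Nat.pow_le_pow_left hn3 2
  have hC12 : 12 * m ≤ max 12 CD * m := Nat.mul_le_mul_right _ (le_max_left _ _)
  have hCD : CD * m ≤ max 12 CD * m := Nat.mul_le_mul_right _ (le_max_right _ _)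
  obtain ⟨α, β, A, B, hA, hB, hper⟩ := hS
  -- Case 1: a common zero of `per_n` and `det A`.
  by_cases hZ : ∃ p : Fin n × Fin n → ℂ, eval p (perPoly (Fin n) ℂ) = 0 ∧ eval p A.det = 0
  · obtain ⟨p, hp, hpA, hrank⟩ := hH n hnH A.det hZ
    have hle := rank_hess0_transl_perPoly_le_of_dual hA hB hper p hp hpA
    omega
  -- Case 2: no common zero: unit dichotomy for `A`.
  push Not at hZ
  rcases hU n hn3 m A hA hZ with ⟨c, hc⟩ | hle
  swap
  · omega
  -- `det A = c` with `c ≠ 0` (the origin is a zero of `per_n`): the isolated unipotent sub-case.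
  have hc0 : c ≠ 0 := by
    have h := hZ 0 (by rw [MvPolynomial.eval_zero]; exact constantCoeff_perPoly ℂ hn1)
    rw [hc, eval_C] at h
    exact h
  have hrep : DualUnipotentRepr n m := ⟨α, β, c, A, B, hA, hB, hc0, hc, hper⟩
  exact (hD n hnD m hrep).trans hCD

end Summit.ValiantsHypothesis.ValiantsHypothesis.Cruxes.TwoDimCoefficients.DimTwoCases

end
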